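import Mathlib
import HarnessLib
import HarnessLib.Audit
import Summits.ValiantsHypothesis.Statement
import Literature.Computability.AlgebraicComplexity.GCTObstructions
import Literature.Computability.AlgebraicComplexity.OrbitClosure
import Literature.Computability.AlgebraicComplexity.OrbitCoordinateRing
import Summits.ValiantsHypothesis.ValiantsHypothesis.Theorems.BorderApolarityGctBridgeRoute
import HarnessLib.Audit.Status.Attr

/-!
Route: IntegralGCT

DORMANT since 2026-08-22T05:30:23Z (reconciler: no traction for 5.1 d (last activity item-evidence-added at 2026-08-17T02:31:56Z); parked, not closed — `ledger route dormant route-ValiantsHypothesis-IntegralGCT --off` to reactivate) — unstaffed, not closed; items shared with open routes are served there. `ledger route dormant <id> --off` reactivates.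

# Route IntegralGCT — integral (lattice / torsion) obstructions in geometric complexity theory

**Thesis X (words).** Work over ℤ instead of ℂ. For a form f with integer coefficients (det_m, the
padded permanent
X₀₀^(m−n)·per_n) the degree-d piece ℂ[Δ(f)]_d of the coordinate ring of the orbit closure carries a
canonical full-rank lattice
Λ_{f,d} := classes of degree-d forms with INTEGER coefficients in the coefficient coordinates (a
U_ℤ-admissible ℤ-form). If
pp := X₀₀^(m−n) per_n ∈ Δ(det_m), the canonical restriction ℂ[Δ det_m]_d ↠ ℂ[Δ pp]_d is
GL_{m²}(ℂ)-equivariant AND maps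
Λ_{det,d} onto Λ_{pp,d}. Hence: if for some d there is NO GL-equivariant linear map ℂ[Δ det_m]_d →
ℂ[Δ pp]_d carrying the
lattice onto the lattice (an INTEGRAL OBSTRUCTION), then pp ∉ Δ(det_m). Integral obstructions refine
multiplicity obstructions
(lattice-onto-lattice forces surjectivity) and are certified, prime by prime, by flips of d_p(f; d,
λ) := number of weight-λ
generators of the flat mod-p reduction Λ_{f,d} ⊗ 𝔽_p over the hyperalgebra Borel (= multiplicity +
p-torsion of the
lowest-weight coinvariants) — data invisible over ℂ (card
ValiantsHypothesis/ValiantsHypothesis/integral-gct-torsion).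
X: integral obstructions exist throughout the quasi-polynomial padding window: for every c, for all
large n and all m with
n ≤ m ≤ 2^((log₂ n + c)^c), some degree d admits no lattice-preserving GL-equivariant map ℂ[Δ
det_m]_d → ℂ[Δ pp]_d.

**X (Lean, elaborates; decl IntegralFlipQP):** `∀ c, ∃ n₀, ∀ n ≥ n₀, ∀ m [NeZero m], n ≤ m → m ≤
2^((Nat.log 2 n + c)^c) →
∃ d, ¬ ∃ φ : Representation.IntertwiningMap (orbitCoordRepDeg (detPoly (Fin m) ℂ) m d)
(orbitCoordRepDeg (paddedPerPoly ℂ n m) m d),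
φ '' Λ(det_m, d) = Λ(pp, d)` with Λ(f,d) = {Ideal.Quotient.mk (orbitVanishingIdeal f m)
(MvPolynomial.map (Int.castRingHom ℂ) F) |
F : MvPolynomial (DegIdx (Fin m × Fin m) m) ℤ, F.IsHomogeneous d} (all constants in
Literature.Computability.AlgebraicComplexity).

**Assembly.** IntegralFlipQP → IntegralPrinciple (degeneration ⇒ lattice-preserving equivariant map;
elementary) → GctThesis of
route GCTMult (pp ∉ Δ(det_m) in the qp window) → [GctToVH: MS2001 Prop 4.4 + dc attained/padded + VP
⇒ qp-dc + hub, all proved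
cone facts: paddedPerPoly_mem_orbitClosure_detPoly_of_hasDetRepr_holds,
isQPBounded_determinantalComplexity_of_isVPFamily_holds,
perFamily_mem_VNP_holds, Hub.valiantsHypothesis_of_not_isVPFamily_per] → ValiantsHypothesis.
Two-layer plan: cruxes now (IntegralFlipQP; TorsionBeyondMultiplicity = the phenomenon exists at
all; CoinvariantTorsionFlip =
the computable d_p certificate, informal until the hyperalgebra-coinvariant definition lands);
glue/splits later (which (d, λ, p);
Smith-normal-form tables in the DIP20/IK20 toy models; per-side lower bounds for d_p via the
stabiliser of per_n).

Rationale: WHY THIS LINE. Every GCT obstruction in print is over ℂ: occurrence (dead for m ≥ n^25, BIP19 =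
barrier GCTOccurrenceObstructions)
and multiplicity (open; route GCTMult). But det_m, padded per_n, their orbits and the whole
surjection template are defined over ℤ,
and in characteristic p complete reducibility fails, so "ℂ[Δ det]_d ↠ ℂ[Δ pp]_d" has strictly more
invariants than multiplicities:
the flat mod-p reductions of the two orbit-closure cones must be compatible equivariant quotients of
one another's lattices. This
imports integral/modular representation theory (Kostant ℤ-forms, Akin–Buchsbaum–Weyman Schur
functors over ℤ, Smith normal forms)
into GCT as a third obstruction axis, monotone for the same formal reason as multiplicities and
needing no positivity/saturation.
Sources: arXiv:1604.06431 (BIP19), arXiv:1901.04576 (DIP20), arXiv:1911.03990 (IK20),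
arXiv:0907.2850 (BLMW11), Kumar2015,
AkinBuchsbaumWeyman1982, MulmuleySohoni2001/2008, Landsberg2017 ch. 8–10; card integral-gct-torsion
(novelty audit: new-mechanism).
RANKED CRUXES. #2 IntegralFlipQP (typed): integral obstructions in the whole qp window — hardest,
VH-strength via GctThesis.
#3 TorsionBeyondMultiplicity (typed): for SOME (n, m, d), n ≤ m, an integral obstruction exists
where no multiplicity obstruction
does — the decisive existence question for the new axis (cheap direction: toy computations; a proof
anywhere is news).
#4 CoinvariantTorsionFlip (informal; needs def hyperalgebraCoinvariants): some (d, λ, p) with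
d_p(pp; d, λ) > d_p(det_m; d, λ) in
the qp window — the computable certificate implying #2 degree by degree.
SUPPORT (provable now): IntegralPrinciple (monotonicity: orbitCoordRestrict maps integer forms to
integer forms, onto);
IntegralRefinesMultiplicity (lattice Λ_{g,d} spans ℂ[Δ g]_d ⇒ lattice-onto-lattice maps are
surjective); GctToVH (compose
gct_assembly, DetQP assembly and hub with the proved cone facts); negative side
NoIntegralObstructionBarrier (integral analogue of
BIP19 / of GCTMult.GctNoMultBarrier: no integral obstruction once m ≥ n^c₀) — its proof closes the
route (window contains n^c₀).
KILL CRITERIA. (i) NoIntegralObstructionBarrier proved; (ii) a theorem "admissible lattices in ℂ[Δ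
det_m]_d and ℂ[Δ pp]_d are
determined up to equivariant isomorphism by multiplicities" (then integral = multiplicity
obstruction and the route merges into
GCTMult); (iii) refutation of TorsionBeyondMultiplicity in all toy ranges computed plus a structural
reason.
NOT DECOMPOSED YET. Choice of (d, λ, p); the per-side LOWER bounds on d_p
(stabiliser/double-stabiliser methods of BLMW11 §5,
IK20 transposed to 𝔽_p); relation of Λ_{det,d} to Kumar's description of ℂ[Δ det] in low degrees;
homogeneous (padding-free,
trace-power) variant where GCTMatrixPowering's no-go does not speak. No third layer will be filed;
lemmas ride with --supports.
NOVELTY (short; full in the novelty field). Nearest prior: BIP19/DIP20/IK20/BLMW11/Kumar2015 — all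
obstructions over ℂ; modular
plethysm / ABW82 give the lattices but no complexity use; Derksen–Makam (polystability in positive
characteristic) is orbit geometry
in char p without containment obstructions. Delta: obstructions from the INTEGRAL structure of
orbit-closure coordinate rings
(lattice-preserving equivariant surjections; d_p flips), typed and monotone. Grade claimed:
new-mechanism (audit-11 concurs).
BARRIERS (short; full in the barriers field). GCTOccurrenceObstructions: evaded formally (never
compares 0 vs >0; refines
multiplicities). GCTUsefulModules: applies verbatim to which λ can carry anything on the pp side —
respected, not evaded.
NotViaSaturations / KroneckerPlethysmHardness: not engaged (no saturation, no positivity-in-P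
hypothesis; torsion dies under
stretching, which is the point). GCTMatrixPowering: orbit-occurrence in the homogeneous setting only
— does not address lattices.
PermanentCharTwo: N/A — membership is over ℂ; p is an auxiliary prime of the lattice, per is never
reduced mod 2 as a polynomial.
Honest bet: no theorem says torsion flips exist; none says they cannot. The first datum is a
Smith-normal-form table (crux #3).

Novelty: Nearest prior art (searched: card + audit-11 searches (galaxy --star all "geometric complexity
theory in positive characteristic" 0 rows; galaxy pdf intelligent on GCT over Z / torsion; arXiv
API), re-checked this session with `lit search --source crossref` ("orbit closure coordinate ring
determinant characteristic p representation obstruction" -> Kumar, Compositio 151 (2015) =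
Kumar2015, over C; "plethysm integral form torsion divided powers Schur functor" ->
Akin-Buchsbaum-Weyman 1982 = AkinBuchsbaumWeyman1982, no complexity use), `lit galaxy search "orbit
closure of the determinant" --star all` (Landsberg2017, LMR13, ELSW18 arXiv:1609.02103,
Blaser-Dorfler-Ikenmeyer CCC21 — all over C), `lit search --hybrid` local (Landsberg2017
pp.179,247)): arXiv:1604.06431 (BIP19: occurrence obstructions dead), arXiv:1901.04576 (DIP20) and
arXiv:1911.03990 (IK20) (multiplicity obstructions in toy models), arXiv:0907.2850 (BLMW11: the
surjection/multiplicity template), Kumar2015 (representations supported by Delta(det) over C),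
MulmuleySohoni2001/MulmuleySohoni2008 (setup partly characteristic-free, no integral obstruction),
AkinBuchsbaumWeyman1982 (Schur functors over Z: the lattices exist), Derksen-Makam 'Polystability in
positive characteristic' (closed-orbit detection in char p, no containment obstructions). Delta: a
third obstruction axis for det vs padded per — equivariant maps C[Delta det_m]_d -> C[Delta pp]_d
that carry the canonical Z-lattice onto the Z-lattice (equivalently com  [refs: 1609.02103, 1604.06431, 1901.04576, 1911.03990, 0907.2850, Kumar2015, AkinBuchsbaumWeyman1982, Landsberg2017, MulmuleySohoni2001, MulmuleySohoni2008]

Barriers (technique_class: GCT, integral-structure, torsion-obstructions, orbit-closure): technique_class: GCT, integral-structure, torsion-obstructions, orbit-closure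
- Literature.Barriers.ValiantsHypothesis.GCTOccurrenceObstructions (BIP19 Thm 1.4;
OccurrenceObstructionRouteQP refuted in tree): evaded formally — an integral obstruction compares
lattice structure (multiplicity + p-torsion of coinvariants), never '0 vs > 0'; it can hold with all
multiplicities of pp below those of det and positive. The qp window containing m = n^25 is harmless
for the same reason it is harmless for GCTMult.
- Literature.Barriers.ValiantsHypothesis.GCTUsefulModules (Kadish-Landsberg; proved
gctUsefulModules_holds): applies verbatim to WHICH weights can carry anything on the padded side
(long first row, <= m^2+1 parts... of the pp ring); a constraint every d_p search respects, not an
obstruction to lattice flips.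
- Literature.Barriers.ValiantsHypothesis.NotViaSaturations (BHI17/Kumar): not engaged — no
saturation, moment-polytope or stretching argument; torsion is non-asymptotic and typically dies
under stretching, which is exactly why it is invisible to the semigroup methods the barrier kills.
- Literature.Barriers.ValiantsHypothesis.KroneckerPlethysmHardness (IMW17/FI20): not engaged — no
polynomial-time positivity hypothesis; d_p is a Smith-normal-form computation in toy cases and the
route never needs positivity in P.
- Literature.Barriers.ValiantsHypothesis.GCTMatrixPowering (GIP17): stated for ORBIT OCCURRENCE
obstructions in the homogeneous trace-power setting; says nothing a

History (route lifecycle, newest last):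
- 2026-08-15T16:15:56Z · rev 4: dropped CoinvariantTorsionFlip2 — route-repair (cone guardrail, rbadge g2): (a) REROUTE — drop the unused route-level import Literature.Computability.AlgebraicComplexity.GCT (no item references (planner-rbadge-ValiantsHypothesis-IntegralGCT-84a4950d-g2-0)
- 2026-08-22T05:30:23Z · DORMANT — reconciler: no traction for 5.1 d (last activity item-evidence-added at 2026-08-17T02:31:56Z); parked, not closed — `ledger route dormant route-ValiantsHypothes (operator:999:2202758)

sub-problem: ValiantsHypothesis · status: dormant · opened planner-plancards-ValiantsHypothesis-ValiantsHypothesis-20260815w1-2-0 2026-08-15T10:38:39Z · rev 4 · ledger route-ValiantsHypothesis-IntegralGCT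
GENERATED by the gate from the ledger (D-0016/17). Provers cite these decls: `theorem foo : Summit.ValiantsHypothesis.ValiantsHypothesis.Theses.IntegralGCT.<Decl> := …` in Summits/ValiantsHypothesis/ValiantsHypothesis/Theorems/<Name>.lean.
-/

namespace Summit.ValiantsHypothesis.ValiantsHypothesis.Theses.IntegralGCT

open scoped BigOperators Topology Manifold Classical MeasureTheory ProbabilityTheory Matrix InnerProductSpace ComplexConjugate ContinuousMap
open Filter Set Function TopologicalSpace MeasureTheory

attribute [summit_statement] _root_.ValiantsHypothesis

open Literature.PNP

/-- item stmt-ValiantsHypothesis-0978 · crux · rank 2 · open · by planner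
why it might fail: Needs an integral obstruction at EVERY (n,m) in the qp window; none (integral or multiplicity) is known at any m >= n+1 (BIP19 kills only occurrence); if saturated quotient lattices of Z[c]_d are fixed by their C-multiplicities the axis collapses to GCTMult; an integral no-go past m >= n^c0 kills it
sources: arXiv:1604.06431 Thm 1.1, Thm 1.4 (BIP19), arXiv:0907.2850 sec. 2 (BLMW11 surjection template), arXiv:1901.04576 (DIP20), arXiv:1911.03990 (IK20), Kumar2015 (arXiv:1109.5996), AkinBuchsbaumWeyman1982
[crux] Integral obstructions throughout the quasi-polynomial padding window: for every c, all large
n and all m with n <= m <= 2^((log2 n + c)^c), some degree d admits NO GL_{m^2}(C)-equivariant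
linear map C[Delta det_m]_d -> C[Delta X00^(m-n) per_n]_d carrying the canonical Z-lattice (classes
of integer degree-d forms in the coefficient coordinates) onto the Z-lattice. With IntegralPrinciple
this gives GctThesis (route GCTMult) hence DetQP hence VH. Refines GctMultObstructions (stmt-0325):
lattice-onto-lattice forces surjectivity (IntegralRefinesMultiplicity). Certified prime by prime by
d_p flips (crux CoinvariantTorsionFlip). Card integral-gct-torsion; BLMW11 sec. 2 template over Z. -/
@[route_item "route-ValiantsHypothesis-IntegralGCT", crux]
def IntegralFlipQP : Prop :=
  ∀ c : ℕ, ∃ n₀ : ℕ, ∀ n ≥ n₀, ∀ (m : ℕ) [NeZero m], n ≤ m → m ≤ 2 ^ ((Nat.log 2 n + c) ^ c) → ∃ d : ℕ, ¬ ∃ φ : Representation.IntertwiningMap (Literature.Computability.AlgebraicComplexity.orbitCoordRepDeg (Literature.Computability.AlgebraicComplexity.detPoly (Fin m) ℂ) m d) (Literature.Computability.AlgebraicComplexity.orbitCoordRepDeg (Literature.Computability.AlgebraicComplexity.paddedPerPoly ℂ n m) m d), (fun x => ((φ x : Literature.Computability.AlgebraicComplexity.orbitCoordRingDeg (Literature.Computability.AlgebraicComplexity.paddedPerPoly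 ℂ n m) m d) : Literature.Computability.AlgebraicComplexity.OrbitCoordRing (Literature.Computability.AlgebraicComplexity.paddedPerPoly ℂ n m) m)) '' {x | ∃ F : MvPolynomial (Literature.Computability.AlgebraicComplexity.DegIdx (Fin m × Fin m) m) ℤ, F.IsHomogeneous d ∧ Ideal.Quotient.mk (Literature.Computability.AlgebraicComplexity.orbitVanishingIdeal (Literature.Computability.AlgebraicComplexity.detPoly (Fin m) ℂ) m) (MvPolynomial.map (Int.castRingHom ℂ) F) = (x : Literature.Computability.AlgebraicComplexity.OrbitCoordRing (Literature.Computability.AlgebraicComplexity.detPoly (Fin m) ℂ) m)} = {y | ∃ F : MvPolynomial (Literature.Computability.AlgebraicComplexity.DegIdx (Fin m × Fin m) m) ℤ, F.IsHomogeneous d ∧ Ideal.Quotient.mk (Literature.Computability.AlgebraicComplexity.orbitVanishingIdeal (Literature.Computability.AlgebraicComplexity.paddedPerPoly ℂ n m) m) (MvPolynomial.map (Int.castRingHom ℂ) F) = y}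

/-- item stmt-ValiantsHypothesis-0979 · crux · rank 3 · open · by planner
why it might fail: A witness needs n >= 3, m < border-dc(per_n), d >= first degree of I(Delta det_m): cells where neither coordinate ring is known. Where multiplicities dominate, a C-surjection between two saturated quotients of the same lattice Z[c]_d may always be renormalisable blockwise to lattice-onto-lattice.
sources: arXiv:1901.04576 (DIP20 toy models), arXiv:1911.03990 (IK20), doi:10.1016/j.crma.2016.07.002 = arXiv:1512.02437 (Huttenhain-Lairez, boundary of Delta(det_3)), AlperBogartVelasco2017 (dc(per_3) = 7), arXiv:1004.4802 (LMR13: border-dc(per_m) >= m^2/2, so pp notin Delta(det_m) at (3,3),(3,4)), AkinBuchsbaumWeyman1982 (Schur/Weyl functors over Z: non-isomorphic lattices in one Q-irreducible)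
[crux] The integral axis is genuinely finer SOMEWHERE in the det / padded-permanent family: there
are n <= m and d such that an integral obstruction holds in degree d (no lattice-preserving
equivariant map C[Delta det_m]_d -> C[Delta pp]_d) although NO multiplicity obstruction holds there
(an equivariant surjection exists). Decisive existence question for the new axis; first candidates
(n,m) = (3,3), (3,4) where pp is not in Delta(det_m) (dc(per_3)=7, border >= 5) and the boundary of
Delta(det_3) is described (Huttenhain-Lairez 2016); toy analogues: DIP20 / IK20 models via Smith
normal forms of the coinvariant presentation. Card integral-gct-torsion 'support (decisive and
cheap)'. -/
@[route_item "route-ValiantsHypothesis-IntegralGCT"]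
def TorsionBeyondMultiplicity : Prop :=
  ∃ (n m d : ℕ) (_ : NeZero m), n ≤ m ∧ (¬ ∃ φ : Representation.IntertwiningMap (Literature.Computability.AlgebraicComplexity.orbitCoordRepDeg (Literature.Computability.AlgebraicComplexity.detPoly (Fin m) ℂ) m d) (Literature.Computability.AlgebraicComplexity.orbitCoordRepDeg (Literature.Computability.AlgebraicComplexity.paddedPerPoly ℂ n m) m d), (fun x => ((φ x : Literature.Computability.AlgebraicComplexity.orbitCoordRingDeg (Literature.Computability.AlgebraicComplexity.paddedPerPoly ℂ n m) m d) : Literature.Computability.AlgebraicComplexity.OrbitCoordRing (Literature.Computability.AlgebraicComplexity.paddedPerPoly ℂ n m) m)) '' {x | ∃ F : MvPolynomial (Literature.Computability.AlgebraicComplexity.DegIdx (Fin m × Fin m) m) ℤ, F.IsHomogeneous d ∧ Ideal.Quotient.mk (Literature.Computability.AlgebraicComplexity.orbitVanishingIdeal (Literature.Computability.AlgebraicComplexity.detPoly (Fin m) ℂ) m) (MvPolynomial.map (Int.castRingHom ℂ) F) = (x : Literature.Computability.AlgebraicComplexity.OrbitCoordRing (Literature.Computability.AlgebraicComplexity.detPoly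 (Fin m) ℂ) m)} = {y | ∃ F : MvPolynomial (Literature.Computability.AlgebraicComplexity.DegIdx (Fin m × Fin m) m) ℤ, F.IsHomogeneous d ∧ Ideal.Quotient.mk (Literature.Computability.AlgebraicComplexity.orbitVanishingIdeal (Literature.Computability.AlgebraicComplexity.paddedPerPoly ℂ n m) m) (MvPolynomial.map (Int.castRingHom ℂ) F) = y}) ∧ ¬ Literature.Computability.AlgebraicComplexity.HasMultiplicityObstruction (Literature.Computability.AlgebraicComplexity.detPoly (Fin m) ℂ) (Literature.Computability.AlgebraicComplexity.paddedPerPoly ℂ n m) m d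

-- item stmt-ValiantsHypothesis-1000 · crux · rank 4 · open · by planner — informal only, no Lean statement yet:
--   [crux] (rank 4; informal until def hyperalgebraCoinvariants lands) COINVARIANT TORSION FLIP — the
--   computable certificate for IntegralFlipQP: for every c, for all large n and all m with n <= m <=
--   2^((log2 n + c)^c) there are a degree d, a weight lambda of GL_{m^2} and a prime p with
--   d_p(X00^(m-n) per_n; d, lambda) > d_p(det_m; d, lambda), where for an integer form f, d_p(f; d,
--   lambda) := dim over F_p of the weight-lambda part of the coinvariants of Lambda_{f,d} tensor F_p
--   under the divided-power lowering operators E_ij^(k) (i > j, k >= 1) of the Kostant Z-form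
--   (Lambda_{f,d} = classes of integer

/-- item stmt-ValiantsHypothesis-0980 · support · rank 5 · closed · proved by Summit.ValiantsHypothesis.ValiantsHypothesis.Theorems.IntegralGCTIntegralPrinciple.integralPrinciple_proof @ f0748edbb91c (prover) · by planner
sources: arXiv:0907.2850, MulmuleySohoni2008
[support] Integral obstruction principle (monotonicity), provable now: if g is in Delta(f) (both
over C, any finite variable type) then the canonical restriction orbitCoordRestrict : C[Delta f] ->
C[Delta g] (tree: Literature.Computability.AlgebraicComplexity.orbitCoordRestrict,
orbitVanishingIdeal_le_of_mem_orbitClosure) restricted to degree d is a GL-intertwining map sending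
the class of an integer form F to the class of the same F, hence maps the lattice {classes of
integer homogeneous degree-d forms} of f ONTO that of g. ~60 lines on top of GCTObstructions.lean.
BLMW11 sec. 2 over Z. -/
@[route_item "route-ValiantsHypothesis-IntegralGCT", crux]
def IntegralPrinciple : Prop :=
  ∀ {σ : Type} [Fintype σ] [DecidableEq σ] (f g : MvPolynomial σ ℂ) (m d : ℕ), g ∈ Literature.Computability.AlgebraicComplexity.orbitClosure f → ∃ φ : Representation.IntertwiningMap (Literature.Computability.AlgebraicComplexity.orbitCoordRepDeg f m d) (Literature.Computability.AlgebraicComplexity.orbitCoordRepDeg g m d), (fun x => ((φ x : Literature.Computability.AlgebraicComplexity.orbitCoordRingDeg g m d) : Literature.Computability.AlgebraicComplexity.OrbitCoordRing g m)) '' {x | ∃ F : MvPolynomial (Literature.Computability.AlgebraicComplexity.DegIdx σ m) ℤ, F.IsHomogeneous d ∧ Ideal.Quotient.mk (Literature.Computability.AlgebraicComplexity.orbitVanishingIdeal f m) (MvPolynomial.map (Int.castRingHom ℂ) F) = (x : Literature.Computability.AlgebraicComplexity.OrbitCoordRing f m)} = {y | ∃ F : MvPolynomial (Literature.Computability.AlgebraicComplexity.DegIdx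 σ m) ℤ, F.IsHomogeneous d ∧ Ideal.Quotient.mk (Literature.Computability.AlgebraicComplexity.orbitVanishingIdeal g m) (MvPolynomial.map (Int.castRingHom ℂ) F) = y}

/-- item stmt-ValiantsHypothesis-0981 · support · rank 6 · closed · proved by Summit.ValiantsHypothesis.ValiantsHypothesis.Theorems.integralRefinesMultiplicity_proof @ c7012877bb1f (prover) · by planner
sources: arXiv:1604.06431, arXiv:0907.2850
[support] Provable now: an intertwining map carrying the integral lattice of C[Delta f]_d onto the
integral lattice of C[Delta g]_d is surjective, because every complex degree-d form is a
C-combination of integer ones (monomials), so the lattice spans orbitCoordRingDeg g m d.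
Consequently HasMultiplicityObstruction f g m d implies the integral obstruction: the new axis
refines multiplicities (and GCTMult's cruxes imply this route's). -/
@[route_item "route-ValiantsHypothesis-IntegralGCT"]
def IntegralRefinesMultiplicity : Prop :=
  ∀ {σ : Type} [Fintype σ] [DecidableEq σ] (f g : MvPolynomial σ ℂ) (m d : ℕ) (φ : Representation.IntertwiningMap (Literature.Computability.AlgebraicComplexity.orbitCoordRepDeg f m d) (Literature.Computability.AlgebraicComplexity.orbitCoordRepDeg g m d)), (fun x => ((φ x : Literature.Computability.AlgebraicComplexity.orbitCoordRingDeg g m d) : Literature.Computability.AlgebraicComplexity.OrbitCoordRing g m)) '' {x | ∃ F : MvPolynomial (Literature.Computability.AlgebraicComplexity.DegIdx σ m) ℤ, F.IsHomogeneous d ∧ Ideal.Quotient.mk (Literature.Computability.AlgebraicComplexity.orbitVanishingIdeal f m) (MvPolynomial.map (Int.castRingHom ℂ) F) = (x : Literature.Computability.AlgebraicComplexity.OrbitCoordRing f m)} = {y | ∃ F : MvPolynomial (Literature.Computability.AlgebraicComplexity.DegIdx σ m) ℤ, F.IsHomogeneous d ∧ Ideal.Quotient.mk (Literature.Computability.AlgebraicComplexity.orbitVanishingIdeal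 g m) (MvPolynomial.map (Int.castRingHom ℂ) F) = y} → Function.Surjective φ

/-- item stmt-ValiantsHypothesis-0983 · support · rank 7 · closed · proved by Summit.ValiantsHypothesis.ValiantsHypothesis.Theorems.BorderApolarityGctBridge.gctBridge_route_proof @ b072793f699b (prover) · by planner
sources: MulmuleySohoni2001, Burgisser2000
[support] Bookkeeping, provable now from PROVED cone facts: the qp Mulmuley-Sohoni thesis (=
GCTMult.GctThesis, stmt-0323) implies ValiantsHypothesis, by composing
Literature.CplxAlg.gct_assembly (Theorems/GCTMultAssembly.lean) with
paddedPerPoly_mem_orbitClosure_detPoly_of_hasDetRepr_holds, hasDetRepr_determinantalComplexity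
(discharged), HasDetRepr.mono, isQPBounded_determinantalComplexity_of_isVPFamily_holds,
mem_VP_ofFintype_iff_holds, perFamily_mem_VNP_holds and
Summit.ValiantsHypothesis.Hub.valiantsHypothesis_of_not_isVPFamily_per (Theorems/HubHub.lean).
Shared glue usable by GCTMult as well. -/
@[route_item "route-ValiantsHypothesis-IntegralGCT", crux]
def GctToVH : Prop :=
  (∀ c : ℕ, ∃ n₀ : ℕ, ∀ n ≥ n₀, ∀ (m : ℕ) [NeZero m], n ≤ m → m ≤ 2 ^ ((Nat.log 2 n + c) ^ c) → Literature.Computability.AlgebraicComplexity.paddedPerPoly ℂ n m ∉ Literature.Computability.AlgebraicComplexity.orbitClosure (Literature.Computability.AlgebraicComplexity.detPoly (Fin m) ℂ)) → ValiantsHypothesis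

/-- `GctToVH` holds: proved by `Summit.ValiantsHypothesis.ValiantsHypothesis.Theorems.BorderApolarityGctBridge.gctBridge_route_proof` @ b072793f699b. -/
theorem GctToVH_holds : GctToVH := _root_.Summit.ValiantsHypothesis.ValiantsHypothesis.Theorems.BorderApolarityGctBridge.gctBridge_route_proof

/-- item stmt-ValiantsHypothesis-0982 · support · rank 9 · open · by planner
why it might fail: It is the poly-padding negation of the route's bet: open even for multiplicities (BIP19 Thm 1.1 is occurrence-only; BlaeserIkenmeyer2025 sec. 12.4); needs a uniform construction of lattice-preserving intertwiners in every degree.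
sources: arXiv:1604.06431 Thm 1.1, BurgisserIkenmeyerPanova2019, BlaeserIkenmeyer2025 sec. 12.4
[support] NEGATIVE SIDE / kill criterion (integral analogue of BIP19 Thm 1.1 and of
GCTMult.GctNoMultBarrier stmt-0890): from some polynomial padding m >= n^c0 on, for EVERY degree d
there is a lattice-preserving GL-equivariant map C[Delta det_m]_d -> C[Delta pp]_d, i.e. no integral
obstruction at all. A proof refutes IntegralFlipQP (the qp window contains m = n^c0 for large n) and
closes the route; not known even for multiplicities (BlaeserIkenmeyer2025 sec. 12.4 records the
multiplicity question as open). Filed unranked for refuters. -/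
@[route_item "route-ValiantsHypothesis-IntegralGCT"]
def NoIntegralObstructionBarrier : Prop :=
  ∃ c₀ n₀ : ℕ, ∀ n ≥ n₀, ∀ (m : ℕ) [NeZero m], n ^ c₀ ≤ m → ∀ d : ℕ, ∃ φ : Representation.IntertwiningMap (Literature.Computability.AlgebraicComplexity.orbitCoordRepDeg (Literature.Computability.AlgebraicComplexity.detPoly (Fin m) ℂ) m d) (Literature.Computability.AlgebraicComplexity.orbitCoordRepDeg (Literature.Computability.AlgebraicComplexity.paddedPerPoly ℂ n m) m d), (fun x => ((φ x : Literature.Computability.AlgebraicComplexity.orbitCoordRingDeg (Literature.Computability.AlgebraicComplexity.paddedPerPoly ℂ n m) m d) : Literature.Computability.AlgebraicComplexity.OrbitCoordRing (Literature.Computability.AlgebraicComplexity.paddedPerPoly ℂ n m) m)) '' {x | ∃ F : MvPolynomial (Literature.Computability.AlgebraicComplexity.DegIdx (Fin m × Fin m) m) ℤ, F.IsHomogeneous d ∧ Ideal.Quotient.mk (Literature.Computability.AlgebraicComplexity.orbitVanishingIdeal (Literature.Computability.AlgebraicComplexity.detPoly (Fin m) ℂ) m) (MvPolynomial.map (Int.castRingHom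 ℂ) F) = (x : Literature.Computability.AlgebraicComplexity.OrbitCoordRing (Literature.Computability.AlgebraicComplexity.detPoly (Fin m) ℂ) m)} = {y | ∃ F : MvPolynomial (Literature.Computability.AlgebraicComplexity.DegIdx (Fin m × Fin m) m) ℤ, F.IsHomogeneous d ∧ Ideal.Quotient.mk (Literature.Computability.AlgebraicComplexity.orbitVanishingIdeal (Literature.Computability.AlgebraicComplexity.paddedPerPoly ℂ n m) m) (MvPolynomial.map (Int.castRingHom ℂ) F) = y}

/-- item stmt-ValiantsHypothesis-0984 · assembly · rank 1 · closed · proved by Summit.ValiantsHypothesis.IntegralGCT.assembly_proof @ 50c43a44eac0 (prover) · by planner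
[assembly] IntegralFlipQP -> IntegralPrinciple -> GctToVH -> ValiantsHypothesis: from the flip get,
for each c, an n0 and for all (n,m) in the window a degree d with no lattice-preserving equivariant
map; if pp were in Delta(det_m), IntegralPrinciple would give one; so GctThesis holds and GctToVH
finishes. Five-line term (checked in the planner's Sketch.lean). -/
@[route_item "route-ValiantsHypothesis-IntegralGCT"]
def Assembly : Prop :=
  IntegralFlipQP → IntegralPrinciple → GctToVH → ValiantsHypothesis

/-! D-0027 §2.1 — DECIDING THEOREM (planner-authored via `route open/edit --closes-file`; by planner-rbadge-ValiantsHypothesis-IntegralGCT-84a4950d-g2-0 2026-08-15T16:14:57Z):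
its hypotheses are this route's items and its conclusion the sub-problem Statement (glue_lint), and it elaborates with this file. -/

@[closes "route-ValiantsHypothesis-IntegralGCT"] theorem closes : IntegralFlipQP → IntegralPrinciple → GctToVH → _root_.ValiantsHypothesis := by
  intro hFlip hPrinciple hGctToVH
  refine hGctToVH ?_
  intro c
  obtain ⟨n₀, hn₀⟩ := hFlip c
  refine ⟨n₀, ?_⟩
  intro n hn m _inst hnm hm hmem
  obtain ⟨d, hd⟩ := hn₀ n hn m hnm hm
  exact hd (hPrinciple (Literature.Computability.AlgebraicComplexity.detPoly (Fin m) ℂ) (Literature.Computability.AlgebraicComplexity.paddedPerPoly ℂ n m) m d hmem)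

end Summit.ValiantsHypothesis.ValiantsHypothesis.Theses.IntegralGCT
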